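import Literature.Geometry.Riemannian.PinchingEstimatesLargestCore
import HarnessLib

/-!
# The largest singular value `b₃ = max uᵀBv` along Hamilton's ODE: pointwise algebra
(topic `Geometry/Riemannian`)

Part of the decomposition of `Literature.Geometry.Riemannian.hamilton_chenZhu_pinching`
(`PinchingEstimates.lean`), towards the ODE part of Hamilton 1997, Thm. 1.9 (p. 12:
"`d b₃/dt ≤ (a₃ + c₃)b₃ + 2b₁b₂` and this makes `d/dt ln b₃ ≤ a₃ + c₃ + 2b₁`"; 1986, Lemma 6.1).
In the tree's variational language `b₃` is the maximum of `uᵀBv` over unit `u, v`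
(`HamiltonODE.SingularValueLEExp`). PROVED here, for any `A, B, C`:

* `bilinear_firstOrder` — at a maximising pair `(u, v)` of `uᵀBv` with value `Y`:
  `Bv = Y u` and `ᵗBu = Y v` (equality in Cauchy–Schwarz);
* `bilinear_field_eq` — `uᵀB'v = Y(uᵀAu + vᵀCv) + 2 vᵀ(adj B)u` for `B' = AB + BC + 2B^#`,
  and `Y · vᵀ(adj B)u = det B` (`B · adj B = det B`);
* `abs_det_le_of_max` — `|det B| ≤ |ᵗBw| · Y²` for every unit `w` (the variational
  `b₁b₂b₃ ≤ |ᵗBw| b₃²`: triple product, Lagrange's identity), and the same with `|Bz|`;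
* `exists_diag_basis_of_min` — for symmetric `A` with `a₁ + a₂ > 0`, a minimising unit vector
  `w` extends to an orthonormal basis `(w, y, y')` diagonalising the form with
  `(yᵀAy)(y'ᵀAy') ≥ (wᵀAw) · max zᵀAz` (the variational `a₂a₃ ≥ a₁a₃`, Hamilton p. 12).

## References

* R. S. Hamilton, Comm. Anal. Geom. 5 (1997), §2.1, Thm. 1.9 and its proof (pp. 12–13). [Hamilton1997]
* R. S. Hamilton, J. Differential Geom. 24 (1986), §6, Lemma 6.1 (p. 167). [Hamilton1986]
-/

noncomputable section

open Set Real
open scoped Matrix BigOperators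

namespace Literature.Geometry.Riemannian

namespace HamiltonODE

variable {A B C : Matrix (Fin 3) (Fin 3) ℝ}

/-! ### First-order conditions for the bilinear maximum -/

/-- If `|q|² ≤ Y²`, `u·q = Y` and `|u| = 1` then `q = Y u`. [folklore] -/
theorem eq_smul_of_dot_eq {q u : Fin 3 → ℝ} {Y : ℝ} (hu : u ⬝ᵥ u = 1) (huq : u ⬝ᵥ q = Y)
    (hq : q ⬝ᵥ q ≤ Y ^ 2) : q = Y • u := by
  have h : (q - Y • u) ⬝ᵥ (q - Y • u) ≤ 0 := by
    simp only [sub_dotProduct, dotProduct_sub, dotProduct_smul, smul_dotProduct, smul_eq_mul, hu,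
      huq, dotProduct_comm q u]
    nlinarith
  have h0 : (q - Y • u) ⬝ᵥ (q - Y • u) = 0 :=
    le_antisymm h (Finset.sum_nonneg fun i _ ↦ mul_self_nonneg _)
  exact sub_eq_zero.1 (dotProduct_self_eq_zero.1 h0)

/-- The value of `u'·q` at `u' = q/|q|` is `|q|`, so a bound `Y` on such values bounds `|q|²` by
`Y²`. [folklore] -/
theorem dot_self_le_sq_of_bound {q : Fin 3 → ℝ} {Y : ℝ} (hY : 0 ≤ Y)
    (h : ∀ u' : Fin 3 → ℝ, u' ⬝ᵥ u' = 1 → u' ⬝ᵥ q ≤ Y) : q ⬝ᵥ q ≤ Y ^ 2 := by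
  have := normSq_mulTranspose_le_sq_of_bound (N := (1 : Matrix (Fin 3) (Fin 3) ℝ)) (u := q) hY
    (fun v hv ↦ by rw [Matrix.one_mulVec, dotProduct_comm]; exact h v hv)
  simpa using this

/-- **First-order conditions at a maximising pair of `uᵀBv`**: `Bv = Y u` and `ᵗBu = Y v`,
`Y = uᵀBv`. [folklore] -/
theorem bilinear_firstOrder {u v : Fin 3 → ℝ} (hu : u ⬝ᵥ u = 1) (hv : v ⬝ᵥ v = 1)
    (hmax : ∀ u' v' : Fin 3 → ℝ, u' ⬝ᵥ u' = 1 → v' ⬝ᵥ v' = 1 → u' ⬝ᵥ (B *ᵥ v') ≤ u ⬝ᵥ (B *ᵥ v)) :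
    B *ᵥ v = (u ⬝ᵥ (B *ᵥ v)) • u ∧ Bᵀ *ᵥ u = (u ⬝ᵥ (B *ᵥ v)) • v := by
  have hY : 0 ≤ u ⬝ᵥ (B *ᵥ v) := by
    have h := hmax (-u) v (by simp [hu]) hv
    rw [neg_dotProduct] at h
    linarith
  constructor
  · exact eq_smul_of_dot_eq hu rfl (dot_self_le_sq_of_bound hY fun u' hu' ↦ hmax u' v hu' hv)
  · refine eq_smul_of_dot_eq hv ?_ (dot_self_le_sq_of_bound hY fun v' hv' ↦ ?_)
    · rw [dotProduct_comm, Matrix.dotProduct_mulVec, ← Matrix.mulVec_transpose]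
    · have := hmax u v' hu hv'
      rwa [Matrix.dotProduct_mulVec, ← Matrix.mulVec_transpose, dotProduct_comm] at this

/-! ### `uᵀB'v` at the maximising pair -/

/-- **`Y · vᵀ(adj B)u = det B`** when `ᵗBu = Y v` (`B · adj B = det B · 1`). [folklore] -/
theorem adj_term_eq {u v : Fin 3 → ℝ} {Y : ℝ} (hu : u ⬝ᵥ u = 1) (hBu : Bᵀ *ᵥ u = Y • v) :
    Y * (v ⬝ᵥ (B.adjugate *ᵥ u)) = B.det := by
  have h : (Bᵀ *ᵥ u) ⬝ᵥ (B.adjugate *ᵥ u) = B.det := by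
    rw [Matrix.mulVec_transpose, ← Matrix.dotProduct_mulVec, Matrix.mulVec_mulVec, Matrix.mul_adjugate,
      Matrix.smul_mulVec, Matrix.one_mulVec, dotProduct_smul, hu, smul_eq_mul, mul_one]
  rw [hBu, smul_dotProduct, smul_eq_mul] at h
  exact h

/-- **`uᵀB'v` at a maximising pair**: `uᵀ(AB + BC + 2B^#)v = Y(uᵀAu + vᵀCv) + 2vᵀ(adj B)u`
(Hamilton 1986, Lemma 6.1: "`d b₃/dt ≤ a₃b₃ + b₃c₃ + 2b₁b₂`"). [cite: Hamilton1997, §2.1, Thm. 1.9 (proof, p. 12)] -/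
theorem bilinear_field_eq {u v : Fin 3 → ℝ} {Y : ℝ} (hBv : B *ᵥ v = Y • u)
    (hBu : Bᵀ *ᵥ u = Y • v) :
    u ⬝ᵥ ((A * B + B * C + (2 : ℝ) • B.sharp) *ᵥ v) =
      Y * (u ⬝ᵥ (A *ᵥ u) + v ⬝ᵥ (C *ᵥ v)) + 2 * (v ⬝ᵥ (B.adjugate *ᵥ u)) := by
  rw [Matrix.add_mulVec, Matrix.add_mulVec, dotProduct_add, dotProduct_add, ← Matrix.mulVec_mulVec,
    hBv, Matrix.mulVec_smul, dotProduct_smul, ← Matrix.mulVec_mulVec, Matrix.dotProduct_mulVec u B,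
    ← Matrix.mulVec_transpose, hBu, smul_dotProduct, Matrix.smul_mulVec, dotProduct_smul, Matrix.sharp,
    Matrix.dotProduct_transpose_mulVec]
  simp only [smul_eq_mul]
  ring

/-! ### `|det B| ≤ |ᵗBw| b₃²` -/

/-- Cauchy–Schwarz for the dot product on `ℝ³`. [folklore] -/
theorem dot_sq_le (a b : Fin 3 → ℝ) : (a ⬝ᵥ b) ^ 2 ≤ (a ⬝ᵥ a) * (b ⬝ᵥ b) := by
  have h := quad_cauchySchwarz (A := (1 : Matrix (Fin 3) (Fin 3) ℝ)) Matrix.isSymm_one (a := a)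
    (b := b) (fun t ↦ by rw [Matrix.one_mulVec]; exact Finset.sum_nonneg fun i _ ↦ mul_self_nonneg _)
  simpa using h

/-- **`|det B| ≤ |ᵗBw| · Y²`** for a unit `w`, when `u'ᵀBv' ≤ Y` for all unit `u', v'`
(variational `b₁b₂b₃ ≤ |ᵗBw| b₃ b₃`): in an orthonormal basis `(w, e₂, e₃)` the determinant is
the triple product of `ᵗBw, ᵗBe₂, ᵗBe₃`. [folklore] -/
theorem abs_det_le_of_max {Y : ℝ} (hY : 0 ≤ Y)
    (hmax : ∀ u' v' : Fin 3 → ℝ, u' ⬝ᵥ u' = 1 → v' ⬝ᵥ v' = 1 → u' ⬝ᵥ (B *ᵥ v') ≤ Y)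
    {w : Fin 3 → ℝ} (hw : w ⬝ᵥ w = 1) :
    |B.det| ≤ ((Bᵀ *ᵥ w) ⬝ᵥ (Bᵀ *ᵥ w)).sqrt * Y ^ 2 := by
  obtain ⟨e₂, e₃, h₂, h₃, hw₂, hw₃, h₂₃⟩ := exists_orthonormal_complement hw
  set R : Matrix (Fin 3) (Fin 3) ℝ := Matrix.of ![w, e₂, e₃] with hR
  have hRRt : R * Rᵀ = 1 := frame3_mul_transpose hw h₂ h₃ hw₂ hw₃ h₂₃
  have hdetR : R.det ^ 2 = 1 := by
    have := congrArg Matrix.det hRRt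
    rwa [Matrix.det_mul, Matrix.det_transpose, Matrix.det_one, ← sq] at this
  -- rows of `R B` are `ᵗBw, ᵗBe₂, ᵗBe₃`
  have hRB : R * B = Matrix.of ![Bᵀ *ᵥ w, Bᵀ *ᵥ e₂, Bᵀ *ᵥ e₃] := by
    ext i j
    simp only [Matrix.mul_apply, Matrix.of_apply, Fin.sum_univ_three]
    fin_cases i <;> simp [R, Matrix.mulVec, dotProduct, Fin.sum_univ_three, Matrix.transpose_apply] <;> ring
  have hdet : B.det ^ 2 = ((Bᵀ *ᵥ w) ⬝ᵥ ((Bᵀ *ᵥ e₂) ⨯₃ (Bᵀ *ᵥ e₃))) ^ 2 := by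
    rw [triple_product_eq_det, show (![Bᵀ *ᵥ w, Bᵀ *ᵥ e₂, Bᵀ *ᵥ e₃] : Matrix (Fin 3) (Fin 3) ℝ) =
      R * B from hRB.symm, Matrix.det_mul, mul_pow, hdetR, one_mul]
  -- bounds on the three factors
  have hn : ∀ e : Fin 3 → ℝ, e ⬝ᵥ e = 1 → (Bᵀ *ᵥ e) ⬝ᵥ (Bᵀ *ᵥ e) ≤ Y ^ 2 := fun e he ↦
    normSq_mulTranspose_le_sq_of_bound hY fun v hv ↦ hmax e v he hv
  have h1 := dot_sq_le (Bᵀ *ᵥ w) ((Bᵀ *ᵥ e₂) ⨯₃ (Bᵀ *ᵥ e₃))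
  have h2 : ((Bᵀ *ᵥ e₂) ⨯₃ (Bᵀ *ᵥ e₃)) ⬝ᵥ ((Bᵀ *ᵥ e₂) ⨯₃ (Bᵀ *ᵥ e₃)) ≤
      ((Bᵀ *ᵥ e₂) ⬝ᵥ (Bᵀ *ᵥ e₂)) * ((Bᵀ *ᵥ e₃) ⬝ᵥ (Bᵀ *ᵥ e₃)) := by
    rw [cross_dot_cross, dotProduct_comm (Bᵀ *ᵥ e₃) (Bᵀ *ᵥ e₂)]
    nlinarith [sq_nonneg ((Bᵀ *ᵥ e₂) ⬝ᵥ (Bᵀ *ᵥ e₃))]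
  have hq0 : 0 ≤ (Bᵀ *ᵥ w) ⬝ᵥ (Bᵀ *ᵥ w) := Finset.sum_nonneg fun i _ ↦ mul_self_nonneg _
  have hq2 : 0 ≤ (Bᵀ *ᵥ e₂) ⬝ᵥ (Bᵀ *ᵥ e₂) := Finset.sum_nonneg fun i _ ↦ mul_self_nonneg _
  have hq3 : 0 ≤ (Bᵀ *ᵥ e₃) ⬝ᵥ (Bᵀ *ᵥ e₃) := Finset.sum_nonneg fun i _ ↦ mul_self_nonneg _
  have hsq : B.det ^ 2 ≤ ((Bᵀ *ᵥ w) ⬝ᵥ (Bᵀ *ᵥ w)) * (Y ^ 2) ^ 2 := by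
    rw [hdet]
    calc ((Bᵀ *ᵥ w) ⬝ᵥ ((Bᵀ *ᵥ e₂) ⨯₃ (Bᵀ *ᵥ e₃))) ^ 2
        ≤ ((Bᵀ *ᵥ w) ⬝ᵥ (Bᵀ *ᵥ w)) * (((Bᵀ *ᵥ e₂) ⬝ᵥ (Bᵀ *ᵥ e₂)) * ((Bᵀ *ᵥ e₃) ⬝ᵥ (Bᵀ *ᵥ e₃))) :=
          h1.trans (mul_le_mul_of_nonneg_left h2 hq0)
      _ ≤ ((Bᵀ *ᵥ w) ⬝ᵥ (Bᵀ *ᵥ w)) * (Y ^ 2 * Y ^ 2) :=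
          mul_le_mul_of_nonneg_left (mul_le_mul (hn e₂ h₂) (hn e₃ h₃) hq3 (sq_nonneg Y)) hq0
      _ = ((Bᵀ *ᵥ w) ⬝ᵥ (Bᵀ *ᵥ w)) * (Y ^ 2) ^ 2 := by ring
  have := Real.sqrt_le_sqrt hsq
  rwa [Real.sqrt_sq_eq_abs, Real.sqrt_mul hq0, Real.sqrt_sq (sq_nonneg Y)] at this

/-- The same bound with `|Bz|` (apply the previous one to `ᵗB`). [folklore] -/
theorem abs_det_le_of_max' {Y : ℝ} (hY : 0 ≤ Y)
    (hmax : ∀ u' v' : Fin 3 → ℝ, u' ⬝ᵥ u' = 1 → v' ⬝ᵥ v' = 1 → u' ⬝ᵥ (B *ᵥ v') ≤ Y)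
    {z : Fin 3 → ℝ} (hz : z ⬝ᵥ z = 1) :
    |B.det| ≤ ((B *ᵥ z) ⬝ᵥ (B *ᵥ z)).sqrt * Y ^ 2 := by
  have h := abs_det_le_of_max (B := Bᵀ) hY (fun u' v' hu' hv' ↦ by
    rw [Matrix.dotProduct_transpose_mulVec]; exact hmax v' u' hv' hu') hz
  rwa [Matrix.det_transpose, Matrix.transpose_transpose] at h

/-! ### The minimising eigenvector of `A`: a diagonalising basis with `d₁d₂ ≥ a₁ · a₃` -/

/-- For symmetric `A` with `a₁ + a₂ ≥ m > 0`, a unit minimiser `w` of the Rayleigh quotient and a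
unit maximiser `u₃`, there is an orthonormal basis `(w, y, y')` in which the form of `A` is
diagonal and `(yᵀAy)(y'ᵀAy') ≥ (wᵀAw)(u₃ᵀAu₃)` (Hamilton, p. 12: "`2a₂a₃ ≥ 2a₁a₃`"; in the generic
case `y = u₃ ⊥ w`). [cite: Hamilton1997, §2.1, Thm. 1.9 (proof, p. 12)] -/
theorem exists_diag_basis_of_min (hA : A.IsSymm) {m : ℝ} (hm : 0 < m)
    (h12 : A.TwoSmallestEigenvaluesSumGE m) {w u₃ : Fin 3 → ℝ} (hw : w ⬝ᵥ w = 1) (hu₃ : u₃ ⬝ᵥ u₃ = 1)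
    (hmin : ∀ z ∈ unitSet, w ⬝ᵥ (A *ᵥ w) ≤ z ⬝ᵥ (A *ᵥ z))
    (hmax : ∀ z ∈ unitSet, z ⬝ᵥ (A *ᵥ z) ≤ u₃ ⬝ᵥ (A *ᵥ u₃)) :
    ∃ y y' : Fin 3 → ℝ, y ⬝ᵥ y = 1 ∧ y' ⬝ᵥ y' = 1 ∧ w ⬝ᵥ y = 0 ∧ w ⬝ᵥ y' = 0 ∧ y ⬝ᵥ y' = 0 ∧
      w ⬝ᵥ (A *ᵥ y) = 0 ∧ w ⬝ᵥ (A *ᵥ y') = 0 ∧ y ⬝ᵥ (A *ᵥ y') = 0 ∧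
      (w ⬝ᵥ (A *ᵥ w)) * (u₃ ⬝ᵥ (A *ᵥ u₃)) ≤ (y ⬝ᵥ (A *ᵥ y)) * (y' ⬝ᵥ (A *ᵥ y')) := by
  have hw0 : ∀ z : Fin 3 → ℝ, z ⬝ᵥ w = 0 → w ⬝ᵥ (A *ᵥ z) = 0 :=
    fun z hz ↦ cross_eq_zero_of_min hA hw hmin hz
  have hu0 : ∀ z : Fin 3 → ℝ, z ⬝ᵥ u₃ = 0 → u₃ ⬝ᵥ (A *ᵥ z) = 0 :=
    fun z hz ↦ cross_eq_zero_of_max hA hu₃ hmax hz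
  rcases (hmin u₃ hu₃).eq_or_lt with heq | hlt
  · -- all Rayleigh quotients are equal
    have hall : ∀ z : Fin 3 → ℝ, z ⬝ᵥ z = 1 → z ⬝ᵥ (A *ᵥ z) = w ⬝ᵥ (A *ᵥ w) :=
      fun z hz ↦ le_antisymm (by rw [heq]; exact hmax z hz) (hmin z hz)
    have hcross : ∀ e z : Fin 3 → ℝ, e ⬝ᵥ e = 1 → z ⬝ᵥ e = 0 → e ⬝ᵥ (A *ᵥ z) = 0 :=
      fun e z he hz ↦ cross_eq_zero_of_min hA he (fun z' hz' ↦ by rw [hall e he, hall z' hz']) hz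
    obtain ⟨y, y', hy, hy', hwy, hwy', hyy'⟩ := exists_orthonormal_complement hw
    refine ⟨y, y', hy, hy', hwy, hwy', hyy', hw0 y (by rw [dotProduct_comm]; exact hwy),
      hw0 y' (by rw [dotProduct_comm]; exact hwy'), hcross y y' hy (by rw [dotProduct_comm]; exact hyy'), ?_⟩
    rw [hall y hy, hall y' hy', hall u₃ hu₃]
  · -- `u₃ ⊥ w`; take `y = u₃`, `y' = w × u₃`
    have huw : u₃ ⬝ᵥ w = 0 := dot_eq_zero_of_eigen hA hu₃ hw hu0 hw0 hlt.ne
    have hwu : w ⬝ᵥ u₃ = 0 := by rw [dotProduct_comm]; exact huw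
    set n := w ⨯₃ u₃ with hn
    have hn1 : n ⬝ᵥ n = 1 := dotProduct_cross_self_of_orthonormal hw hu₃ hwu
    have hwn : w ⬝ᵥ n = 0 := dot_self_cross w u₃
    have hun : u₃ ⬝ᵥ n = 0 := dot_cross_self w u₃
    refine ⟨u₃, n, hu₃, hn1, hwu, hwn, hun, hw0 u₃ huw, hw0 n (by rw [dotProduct_comm]; exact hwn),
      hu0 n (by rw [dotProduct_comm]; exact hun), ?_⟩
    have ha2 : w ⬝ᵥ (A *ᵥ w) ≤ n ⬝ᵥ (A *ᵥ n) := hmin n hn1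
    have hpair : m ≤ w ⬝ᵥ (A *ᵥ w) + n ⬝ᵥ (A *ᵥ n) := h12 w n hw hn1 hwn
    have hM : n ⬝ᵥ (A *ᵥ n) ≤ u₃ ⬝ᵥ (A *ᵥ u₃) := hmax n hn1
    have hM0 : 0 ≤ u₃ ⬝ᵥ (A *ᵥ u₃) := by linarith
    nlinarith [mul_le_mul_of_nonneg_left ha2 hM0]

end HamiltonODE

end Literature.Geometry.Riemannian

end
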